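import Summits.Ventures.CertifiedArithmetic.Expansions.CompressTopPairAbsorbed
import Mathlib.Tactic.Linarith
import Mathlib.Tactic.Ring
import Mathlib.Tactic.NormNum

/-!
# Two-component COMPRESS outputs are final (packaging of `CompressTopPairAbsorbed`)

New work of the certified-arithmetic venture (ENGINES group: shared numerical engines serving
client cells; rigour lives in the verifiers; every published number belongs to a client cell's
ledger, not to the engines group).

Corollary of `compress_top_absorbed` [this venture] for COMPRESS [Shewchuk1997, §2.7 Theorem 23],
any precision `p ≥ 2`, any round-to-nearest: if `compress fl e = ⟨a, b⟩` has exactly two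
components then `fl(b + a) = b`, both are nonzero, and a second pass returns `⟨a, b⟩` unchanged —
so the non-idempotence of COMPRESS (`CompressNotIdempotent`) needs at least three output
components.  (This block was farm-checked inside the 2026-08-24 draft of `CompressTopPairAbsorbed`
and split off for the 400-line limit; it only needs that module to be built.)
-/

namespace Summit.Ventures.CertifiedArithmetic.Expansions

open Literature.ComputerArithmetic.JeannerodRump2018
open Literature.ComputerArithmetic.BoldoJeannerodMelquiondMuller2023 hiding twoSum twoSum_fst
open Literature.ComputerArithmetic.Shewchuk1997

variable {p : ℕ} {emin : ℤ}

/-- **TWO-COMPONENT OUTPUTS ARE FINAL** (`p ≥ 2`): if `compress fl e = ⟨a, b⟩` then `⟨a, b⟩` is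
a chain — `fl(b + a) = b`, `a ≠ 0`, `b ≠ 0` — and a second pass returns it unchanged.  (So a
witness of non-idempotence needs a first output with at least three components, as those of
`CompressNotIdempotent` have.) [cite: Shewchuk1997, §2.7 Thm 23 p. 331–333] -/
theorem compress_pair_output_fixed (hp : 2 ≤ p) {fl : ℚ → ℚ} (hfl : IsRoundNearest p emin fl)
    {e : List ℚ} (he : ∀ x ∈ e, IsFloat p emin x) (hexp : IsExpansion 1 e) {a b : ℚ}
    (h : compress fl e = [a, b]) :
    fl (b + a) = b ∧ a ≠ 0 ∧ b ≠ 0 ∧ compress fl [a, b] = [a, b] := by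
  have hp1 : 1 ≤ p := le_trans (by norm_num) hp
  have htop : fl (b + a) = b :=
    compress_top_absorbed hp hfl he hexp (l := []) (by rw [h, List.nil_append])
  have out := compress_nonoverlapping hp hfl he hexp
  rw [h] at out
  have hnz : a ≠ 0 ∧ b ≠ 0 := by
    rcases out.nz with hall | hsing
    · exact ⟨hall a (by simp), hall b (by simp)⟩
    · exact absurd (congrArg List.length hsing) (by simp)
  have ha : IsFloat p emin a := out.floats a (by simp)
  have hb : IsFloat p emin b := out.floats b (by simp)
  have hbel : Below 1 a b := (List.pairwise_cons.mp out.exp).1 b (by simp)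
  have hab : |a| ≤ |b| := (hbel.abs_lt le_rfl hnz.2).le
  refine ⟨htop, hnz.1, hnz.2, ?_⟩
  obtain ⟨h1, -, h2, -⟩ := fastTwoSum_exact hp1 hfl hb ha hab
  have hF : fastTwoSum fl b a = (b, a) := by
    refine Prod.ext ?_ ?_
    · rw [h1, htop]
    · rw [h2, htop]; ring
  have hF0 : (fastTwoSum fl b a).2 ≠ 0 := by rw [hF]; exact hnz.1
  have hD : compressDown fl b [a] = ([b], a) := by
    rw [compressDown_cons_of_ne_zero hF0, hF, compressDown_nil]
  have hc : compress fl [a, b] = compressUp fl a [b] := by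
    simp only [compress, List.reverse_cons, List.reverse_nil, List.nil_append, List.cons_append,
      hD, List.reverse_cons, List.reverse_nil, List.nil_append]
  rw [hc, compressUp_cons_of_ne_zero hF0, hF, compressUp_nil]

/-- At `p = 3`, `emin = 0`: e.g. the non-fixed output `⟨−1, −4, −112⟩ = COMPRESS ⟨7, −8, −112⟩`
of `CompressNotIdempotent` has its top pair absorbed, `fl(−112 + −4) = −112` (an instance of
`compress_top_absorbed`), while its bottom pair is not (`−4 + −1 = −5` is a float). -/
example : (-112 : ℚ) + -4 = -116 ∧ (-4 : ℚ) + -1 = -5 := by norm_num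

end Summit.Ventures.CertifiedArithmetic.Expansions
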